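import Literature.NumberTheory.EllipticCurves.IsogenyFrobeniusTraceOfAndreCriterionProofs
import Literature.NumberTheory.Transcendental.AndreCriterionRationalProofs
import HarnessLib

/-!
# Faltings' isogeny theorem for elliptic curves over `ℚ` (traces of Frobenius): the discharge

Topic `Literature/NumberTheory/EllipticCurves`; a proofs-only sibling of `Isogeny.lean` (theorems
only, no named fact introduced). It discharges the named fact
`WeierstrassCurve.isIsogenous_iff_frobeniusTrace_eq` (`Isogeny.lean`; Faltings 1983, §5 Korollar 2,
for elliptic curves over `ℚ`): two globally minimal elliptic curves over `ℚ` are isogenous over `ℚ`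
iff their traces of Frobenius `a_p` agree at all but finitely many primes.

The proof formalised in the tree is Bost's Faltings-free one (Bost 2001, Cor. 2.5 with Thm. 2.3):
`⇐` — finitely many exceptional primes ⇒ the graph of the formal isomorphism
`exp_{E'} ∘ log_E` is `p`-closed for almost all `p` (Hasse invariants agree), whence integer row
denominators of geometric growth for the leaf series (`FormalLeafDenominatorBoundProofs`); the leaf
is uniformised on all of `ℂ` by the Weierstrass functions of the two Néron lattices
(`FormalExpTaylorUniformizationProofs`, `FormalLogExpBaseChangeProofs`, pole clearing in
`LocalParamPoleClearingProofs`); André's algebraicity criterion over `ℚ`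
(`Transcendental/AndreCriterionRationalProofs`, Chambert-Loir, Sém. Bourbaki 886, Thm. 6.2) then
gives an algebraic relation between `x` and the leaf, and an algebraic leaf through the origin of
`E × E'` is (a component of) an isogeny correspondence (`IsogenyOfLeafRelationProofs`,
`IsogenyOfAlgebraicDependenceProofs`); the assembly is
`isIsogenous_iff_frobeniusTrace_eq_of_andreCriterion` (`IsogenyFrobeniusTraceOfAndreCriterionProofs`).
`⇒` — isogenous curves have the same `a_p` at every prime of common good reduction
(`IsogenyFrobeniusTraceProofs`).

## References

* G. Faltings, *Endlichkeitssätze für abelsche Varietäten über Zahlkörpern*, Invent. Math. 73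
  (1983), 349–366, §5 Korollar 2. [Faltings1983Endlichkeit]
* J.-B. Bost, *Algebraic leaves of algebraic foliations over number fields*, Publ. Math. IHÉS 93
  (2001), 161–221, Thm. 2.3, Cor. 2.5, Prop. 3.9. [Bost2001AlgebraicLeaves]
* A. Chambert-Loir, *Théorèmes d'algébricité en géométrie diophantienne (d'après J.-B. Bost,
  Y. André, D. & G. Chudnovsky)*, Sém. Bourbaki 886, Astérisque 282 (2002), Thm. 6.2.
  [ChambertLoir2002Bourbaki]
-/

namespace WeierstrassCurve

/-- **Faltings' isogeny theorem for elliptic curves over `ℚ`, via traces of Frobenius**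
(discharge of the named fact `isIsogenous_iff_frobeniusTrace_eq`): two globally minimal elliptic
curves over `ℚ` are `ℚ`-isogenous iff `a_p(W) = a_p(W')` for all but finitely many primes `p`.
Proved along Bost's route: the assembly `isIsogenous_iff_frobeniusTrace_eq_of_andreCriterion`
fed with André's algebraicity criterion over `ℚ`,
`Literature.NumberTheory.Transcendental.AndreCriterion.exists_relation_of_den_of_uniformization`.
[cite: Faltings1983Endlichkeit, §5 Korollar 2] [cite: Bost2001AlgebraicLeaves, Cor. 2.5] -/
theorem isIsogenous_iff_frobeniusTrace_eq_holds : isIsogenous_iff_frobeniusTrace_eq :=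
  isIsogenous_iff_frobeniusTrace_eq_of_andreCriterion
    Literature.NumberTheory.Transcendental.AndreCriterion.exists_relation_of_den_of_uniformization

end WeierstrassCurve
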